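import Summits.HodgeConjecture.HodgeConjecture.Theorems.K2E3HermitianWittDecomposition
import Literature.NumberTheory.Automorphic.UnitaryGroupIsotropicLineElements
import Literature.NumberTheory.Automorphic.UnitaryGroupFormTransport
import Mathlib.Data.Matrix.ColumnRowPartitioned
import HarnessLib

/-!
# K2 ∕ E3 «EllipticInputs», 13a road A, helper J4 (i)-alg (continued): WITT BASES and the Witt normal form
# `ᵗ(σT)·J·T = W(r, H_an)` of a non-degenerate hermitian matrix

Cell `hodgecm-mathlib` (Track B «K2-LIT»), item h413 = `stmt-HodgeConjecture-24833`; author K2E3-p10 (g2); count-neutral helper for the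
13a line (socket U12-g, road A: K2E3-p13 MEMO `MEMO-13a-admissibility-generalN` §5 «D: a Witt frame = an ordered basis
`(e₁…e_r, [anisotropic block], f_r…f_1)` in which `J` is `wittForm r H_an := antidiag-hyperbolic ⊥ H_an`» and «J4 (i): a similitude
`ᵗ(σT)·H_w·T = wittForm r H_an`»).  PROOF lane: theorems only (no `def`, no `instance`, no `sorry`), over ★ `K2E3HermitianWittDecomposition`
(K2E3-p10 (g2)), ★ `K2E3OrbitClosureHermitianPairs.exists_adapted_basis` (K2E3-p10 (g0)) and the tree's `hermForm` ∕ `formCongr` currency.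

* §1 **`exists_witt_basis`** — abstract form: for `h : V →ₛₗ[σ] V →ₗ[K] K` hermitian non-degenerate (`σ` an involution, `2 ≠ 0`)
  a basis `b` of `V` indexed by `Fin r ⊕ (Fin m ⊕ Fin r)` = `(w ∣ u ∣ w')` with `h(w_i, w_j) = 0 = h(w'_i, w'_j)`, `h(w_i, w'_j) = δ_{ij}`,
  `u ⊥ w, w'`, the middle block ANISOTROPIC (`h(Σ c_k u_k, Σ c_k u_k) = 0 ⇒ c = 0`), and `2r + m = dim V`.
* §2 **`exists_witt_basis_hermForm`** — the same for `V = Kⁿ`, `h = hermForm σ J` (`J` `σ`-hermitian, `det J` a unit), `2r + m = #n`.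
* §3 **`exists_GL_formCongr_eq_wittMatrix`** — matrix packaging: an index bijection `e : Fin r ⊕ (Fin m ⊕ Fin r) ≃ n`, `T ∈ GL_n(K)`
  and an anisotropic `σ`-hermitian `H_an ∈ M_m(K)` with
  `ᵗ(σT)·J·T = reindex e e (fromBlocks 0 [0 ∣ 1] [0 ; 1]ᵀ-shape (fromBlocks H_an 0 0 0))`, i.e. the Witt normal form
  `W(r, H_an) = ⎛0 0 1⎞ ⎜0 H_an 0⎟ ⎝1 0 0⎠` in the block order `(w ∣ u ∣ w')` — the term a defs leaf can name `wittForm r H_an` and match by `rfl`.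
* §4 (ED. 2) **`exists_GL_formCongr_eq_wittMatrix_rev`** — the same with the `f`-slots reversed: pairing block `antidiag(1,…,1)`
  (`δ_{i, rev j}`), the convention in which standard parabolics are block-upper-triangular and `Φ_N` is the case `H_an = (1)`.

References: J. Dieudonné, *La géométrie des groupes classiques* (1971), Chap. I §11; W. Scharlau, *Quadratic and Hermitian Forms* (1985), Ch. 7.
-/

set_option autoImplicit false
set_option linter.dupNamespace false

namespace Summit.HodgeConjecture.HodgeConjecture.Cruxes.H413.K2E3HermitianWittBasis

open Module K2E3OrbitClosureHermitianPairs K2E3HermitianWittDecomposition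
open Literature.NumberTheory.Automorphic Literature.NumberTheory.Automorphic.UnitaryGroup
open scoped Matrix MatrixGroups

/-! ## §1 Witt bases of an abstract hermitian space -/

section Abstract

variable {K : Type*} [Field K] {σ : K →+* K} {V : Type*} [AddCommGroup V] [Module K V] [FiniteDimensional K V]
  (h : V →ₛₗ[σ] V →ₗ[K] K)

/-- **Witt basis.**  A non-degenerate hermitian space over a field with `2 ≠ 0` (involution `σ`) has a basis `(w ∣ u ∣ w')` indexed by
`Fin r ⊕ (Fin m ⊕ Fin r)` with `(w, w')` a hyperbolic frame, `u` orthogonal to it and spanning an ANISOTROPIC subspace, `2r + m = dim V`.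
[cite: Dieudonne1971GroupesClassiques, Chap. I §11] -/
theorem exists_witt_basis (hσ : ∀ a, σ (σ a) = a) (h2 : (2 : K) ≠ 0) (hherm : ∀ x y, h y x = σ (h x y))
    (hnd : ∀ x, (∀ y, h x y = 0) → x = 0) :
    ∃ (r m : ℕ) (b : Basis (Fin r ⊕ (Fin m ⊕ Fin r)) K V),
      (∀ i j, h (b (Sum.inl i)) (b (Sum.inl j)) = 0) ∧
      (∀ i j, h (b (Sum.inr (Sum.inr i))) (b (Sum.inr (Sum.inr j))) = 0) ∧
      (∀ i j, h (b (Sum.inl i)) (b (Sum.inr (Sum.inr j))) = if i = j then 1 else 0) ∧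
      (∀ i k, h (b (Sum.inl i)) (b (Sum.inr (Sum.inl k))) = 0) ∧
      (∀ i k, h (b (Sum.inr (Sum.inr i))) (b (Sum.inr (Sum.inl k))) = 0) ∧
      (∀ c : Fin m → K,
        h (∑ k, c k • b (Sum.inr (Sum.inl k))) (∑ k, c k • b (Sum.inr (Sum.inl k))) = 0 → c = 0) ∧
      2 * r + m = finrank K V := by
  classical
  obtain ⟨r, w, w', hww, hw'w', hww', han⟩ := exists_witt_decomposition h hσ h2 hherm hnd
  have hli := linearIndependent_witt_frame h hherm hww hw'w' hww'
  have hliw : LinearIndependent K w := hli.comp Sum.inl Sum.inl_injective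
  -- the totally isotropic `W = ⟨w⟩` with its basis
  set W := Submodule.span K (Set.range w) with hWdef
  let bW : Basis (Fin r) K W := Basis.span hliw
  have hbW : ∀ i, (bW i : V) = w i := fun i => congrArg Subtype.val (Basis.span_apply hliw i)
  have hWiso : ∀ x ∈ W, ∀ y ∈ W, h x y = 0 := by
    intro x hx y hy
    obtain ⟨c, rfl⟩ := (Submodule.mem_span_range_iff_exists_fun K).1 hx
    obtain ⟨d, rfl⟩ := (Submodule.mem_span_range_iff_exists_fun K).1 hy
    rw [apply_sum_smul_left]
    simp [hww]
  have hww'' : ∀ i j, h (bW i) (w' j) = if i = j then 1 else 0 := fun i j => by rw [hbW]; exact hww' i j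
  -- the orthogonal `U` of the frame and a basis of it
  set U := (Submodule.span K (Set.range (Sum.elim w w'))).orthogonalBilin h with hUdef
  have hU : ∀ v, v ∈ U ↔ (∀ i, h (bW i) v = 0) ∧ ∀ i, h (w' i) v = 0 := fun v => by
    simp only [hbW]; exact mem_orthogonal_frame_iff h hherm hww hw'w' hww' v
  set m := finrank K U with hmdef
  let bU : Basis (Fin m) K U := Module.finBasis K U
  obtain ⟨b, hb1, hb2, hb3, -, -, -, -⟩ := exists_adapted_basis h hherm hWiso bW w' hww'' hw'w' hU bU
  have hwU : ∀ i (k : Fin m), h (w i) (bU k) = 0 := fun i k => by rw [← hbW]; exact (((hU _).1 (bU k).2).1 i)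
  have hw'U : ∀ i (k : Fin m), h (w' i) (bU k) = 0 := fun i k => ((hU _).1 (bU k).2).2 i
  refine ⟨r, m, b, fun i j => ?_, fun i j => ?_, fun i j => ?_, fun i k => ?_, fun i k => ?_, fun c hc => ?_,
    two_mul_add_finrank_orthogonal_eq h hherm hww hw'w' hww'⟩
  · rw [hb1, hb1, hbW, hbW]; exact hww i j
  · rw [hb3, hb3]; exact hw'w' i j
  · rw [hb1, hb3, hbW]; exact hww' i j
  · rw [hb1, hb2, hbW]; exact hwU i k
  · rw [hb3, hb2]; exact hw'U i k
  · -- anisotropy of the middle block: the combination lies in `U`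
    simp only [hb2] at hc
    set u : U := ∑ k, c k • bU k with hudef
    have hcoe : (u : V) = ∑ k, c k • (bU k : V) := by
      simp only [hudef, Submodule.coe_sum, Submodule.coe_smul]
    have hu0 : (u : V) = 0 := by
      obtain ⟨H1, H2⟩ := (hU (u : V)).1 u.2
      refine han (u : V) (fun i => by rw [← hbW]; exact H1 i) H2 ?_
      rw [hcoe]; exact hc
    have hu0' : u = 0 := Subtype.ext hu0
    exact funext fun k => Fintype.linearIndependent_iff.1 bU.linearIndependent c (by rw [← hudef]; exact hu0') k

end Abstract

/-! ## §2 Witt bases of `(Kⁿ, hermForm σ J)` -/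

section MatrixForm

variable {K : Type*} [Field K] (σ : K →+* K) {n : Type*} [Fintype n] [DecidableEq n] (J : Matrix n n K)

/-- `hermForm σ J` is non-degenerate when `det J` is a unit and `σ` is an involution. [folklore] -/
theorem hermForm_nondegenerate (hσ : ∀ a, σ (σ a) = a) (hJd : IsUnit J.det) (x : n → K)
    (hx : ∀ y, hermForm σ J x y = 0) : x = 0 := by
  have hv : Matrix.vecMul (⇑σ ∘ x) J = 0 := by
    funext j
    have := hx (Pi.single j 1)
    rwa [hermForm_apply, Matrix.dotProduct_mulVec, dotProduct_single, mul_one] at this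
  have h0 := Matrix.eq_zero_of_vecMul_eq_zero hJd.ne_zero hv
  funext i
  have hi := congrFun h0 i
  rw [Function.comp_apply, Pi.zero_apply] at hi
  rw [← hσ (x i), hi, map_zero, Pi.zero_apply]

/-- **Witt basis of `(Kⁿ, hermForm σ J)`** for `J` `σ`-hermitian with `det J` a unit, `σ` an involution, `2 ≠ 0`:
a basis `(w ∣ u ∣ w')` with the Witt relations, anisotropic middle block and `2r + m = #n`. [cite: Dieudonne1971GroupesClassiques, Chap. I §11] -/
theorem exists_witt_basis_hermForm (hσ : ∀ a, σ (σ a) = a) (h2 : (2 : K) ≠ 0) (hJ : (J.map σ)ᵀ = J) (hJd : IsUnit J.det) :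
    ∃ (r m : ℕ) (b : Basis (Fin r ⊕ (Fin m ⊕ Fin r)) K (n → K)),
      (∀ i j, hermForm σ J (b (Sum.inl i)) (b (Sum.inl j)) = 0) ∧
      (∀ i j, hermForm σ J (b (Sum.inr (Sum.inr i))) (b (Sum.inr (Sum.inr j))) = 0) ∧
      (∀ i j, hermForm σ J (b (Sum.inl i)) (b (Sum.inr (Sum.inr j))) = if i = j then 1 else 0) ∧
      (∀ i k, hermForm σ J (b (Sum.inl i)) (b (Sum.inr (Sum.inl k))) = 0) ∧
      (∀ i k, hermForm σ J (b (Sum.inr (Sum.inr i))) (b (Sum.inr (Sum.inl k))) = 0) ∧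
      (∀ c : Fin m → K,
        hermForm σ J (∑ k, c k • b (Sum.inr (Sum.inl k))) (∑ k, c k • b (Sum.inr (Sum.inl k))) = 0 → c = 0) ∧
      2 * r + m = Fintype.card n := by
  classical
  set B := Matrix.toLinearMapₛₗ₂' K σ (RingHom.id K) J with hB
  have hBapply : ∀ x y, B x y = hermForm σ J x y := toLinearMapₛₗ₂'_eq_hermForm σ J
  have hherm : ∀ x y, B y x = σ (B x y) := fun x y => by rw [hBapply, hBapply, conj_hermForm σ J hσ hJ]
  have hnd : ∀ x, (∀ y, B x y = 0) → x = 0 := fun x hx =>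
    hermForm_nondegenerate σ J hσ hJd x fun y => by rw [← hBapply]; exact hx y
  obtain ⟨r, m, b, h1, h2', h3, h4, h5, h6, h7⟩ := exists_witt_basis B hσ h2 hherm hnd
  refine ⟨r, m, b, fun i j => ?_, fun i j => ?_, fun i j => ?_, fun i k => ?_, fun i k => ?_, fun c hc => ?_, ?_⟩
  · rw [← hBapply]; exact h1 i j
  · rw [← hBapply]; exact h2' i j
  · rw [← hBapply]; exact h3 i j
  · rw [← hBapply]; exact h4 i k
  · rw [← hBapply]; exact h5 i k
  · exact h6 c (by rw [hBapply]; exact hc)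
  · rw [h7, Module.finrank_fintype_fun_eq_card]

/-! ## §3 The Witt normal form `ᵗ(σT)·J·T = W(r, H_an)` -/

/-- **Witt normal form of a non-degenerate hermitian matrix.**  For `J ∈ Mₙ(K)` `σ`-hermitian with `det J` a unit (`σ` an involution,
`2 ≠ 0`) there are `r, m` with `2r + m = #n`, an index bijection `e : Fin r ⊕ (Fin m ⊕ Fin r) ≃ n`, a change of basis `T ∈ GL_n(K)`
and an ANISOTROPIC `σ`-hermitian `H_an ∈ M_m(K)` such that `ᵗ(σT)·J·T` is, after reindexing by `e`, the block matrix
`W(r, H_an) = fromBlocks 0 (fromCols 0 1) (fromRows 0 1) (fromBlocks H_an 0 0 0)` in the block order `(w ∣ u ∣ w')` — zero on `w × w` and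
`w' × w'`, identity pairing `w × w'`, `H_an` on `u × u`. [cite: Dieudonne1971GroupesClassiques, Chap. I §11] -/
theorem exists_GL_formCongr_eq_wittMatrix (hσ : ∀ a, σ (σ a) = a) (h2 : (2 : K) ≠ 0) (hJ : (J.map σ)ᵀ = J)
    (hJd : IsUnit J.det) :
    ∃ (r m : ℕ) (e : Fin r ⊕ (Fin m ⊕ Fin r) ≃ n) (T : GL n K) (Han : Matrix (Fin m) (Fin m) K),
      2 * r + m = Fintype.card n ∧ (Han.map σ)ᵀ = Han ∧
      (∀ x : Fin m → K, hermForm σ Han x x = 0 → x = 0) ∧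
      formCongr σ T J = Matrix.reindex e e
        (Matrix.fromBlocks (0 : Matrix (Fin r) (Fin r) K)
          (Matrix.fromCols (0 : Matrix (Fin r) (Fin m) K) (1 : Matrix (Fin r) (Fin r) K))
          (Matrix.fromRows (0 : Matrix (Fin m) (Fin r) K) (1 : Matrix (Fin r) (Fin r) K))
          (Matrix.fromBlocks Han 0 0 (0 : Matrix (Fin r) (Fin r) K))) := by
  classical
  obtain ⟨r, m, b, h1, h2', h3, h4, h5, h6, h7⟩ := exists_witt_basis_hermForm σ J hσ h2 hJ hJd
  -- symmetric companions of the relations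
  have h3' : ∀ i j, hermForm σ J (b (Sum.inr (Sum.inr i))) (b (Sum.inl j)) = if i = j then 1 else 0 := fun i j => by
    rw [← conj_hermForm σ J hσ hJ, h3]
    split_ifs with hij hji hji
    · exact map_one σ
    · exact absurd hij.symm hji
    · exact absurd hji.symm hij
    · exact map_zero σ
  have h4' : ∀ i k, hermForm σ J (b (Sum.inr (Sum.inl k))) (b (Sum.inl i)) = 0 := fun i k => by
    rw [← conj_hermForm σ J hσ hJ, h4, map_zero]
  have h5' : ∀ i k, hermForm σ J (b (Sum.inr (Sum.inl k))) (b (Sum.inr (Sum.inr i))) = 0 := fun i k => by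
    rw [← conj_hermForm σ J hσ hJ, h5, map_zero]
  -- the index bijection and the change-of-basis matrix (columns = the Witt basis)
  have hcard : Fintype.card (Fin r ⊕ (Fin m ⊕ Fin r)) = Fintype.card n := by
    simp only [Fintype.card_sum, Fintype.card_fin]; omega
  let e : Fin r ⊕ (Fin m ⊕ Fin r) ≃ n := Fintype.equivOfCardEq hcard
  let Tm : Matrix n n K := Matrix.of fun i j => b (e.symm j) i
  have hcol : Tm.col = fun j => b (e.symm j) := by
    funext j i; rfl
  have hTu : IsUnit Tm := by
    rw [← Matrix.linearIndependent_cols_iff_isUnit, hcol]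
    exact b.linearIndependent.comp e.symm e.symm.injective
  obtain ⟨T, hT⟩ := hTu
  -- the anisotropic kernel's Gram matrix
  let Han : Matrix (Fin m) (Fin m) K := Matrix.of fun k k' => hermForm σ J (b (Sum.inr (Sum.inl k))) (b (Sum.inr (Sum.inl k')))
  have hHan : (Han.map σ)ᵀ = Han := by
    ext k k'
    simp only [Matrix.transpose_apply, Matrix.map_apply, Han, Matrix.of_apply]
    exact conj_hermForm σ J hσ hJ _ _
  -- `hermForm σ Han c c = hermForm σ J (Σ c_k u_k) (Σ c_k u_k)`
  set B := Matrix.toLinearMapₛₗ₂' K σ (RingHom.id K) J with hB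
  have hBapply : ∀ x y, B x y = hermForm σ J x y := toLinearMapₛₗ₂'_eq_hermForm σ J
  have hHanform : ∀ c : Fin m → K,
      hermForm σ Han c c = hermForm σ J (∑ k, c k • b (Sum.inr (Sum.inl k))) (∑ k, c k • b (Sum.inr (Sum.inl k))) := by
    intro c
    have hR : B (∑ k, c k • b (Sum.inr (Sum.inl k))) (∑ k, c k • b (Sum.inr (Sum.inl k))) =
        ∑ k, σ (c k) * ∑ k', c k' * B (b (Sum.inr (Sum.inl k))) (b (Sum.inr (Sum.inl k'))) := by
      rw [apply_sum_smul_left]; simp only [apply_sum_smul_right]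
    rw [← hBapply, hR, hermForm_apply]
    simp only [dotProduct, Matrix.mulVec, Function.comp_apply, Matrix.of_apply, hBapply, Han]
    refine Finset.sum_congr rfl fun k _ => ?_
    congr 1
    exact Finset.sum_congr rfl fun k' _ => mul_comm _ _
  refine ⟨r, m, e, T, Han, h7, hHan, fun x hx => h6 x (by rw [← hHanform]; exact hx), ?_⟩
  -- entrywise comparison: `(ᵗ(σT)·J·T)_{ij} = h(T e_i, T e_j)`
  have hentry : ∀ i j, (((T : Matrix n n K).map σ)ᵀ * J * (T : Matrix n n K)) i j =
      hermForm σ J (fun a => (T : Matrix n n K) a i) (fun a => (T : Matrix n n K) a j) := fun i j => by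
    rw [Matrix.mul_assoc, Matrix.mul_apply]; rfl
  ext i j
  change (((T : Matrix n n K).map σ)ᵀ * J * (T : Matrix n n K)) i j = _
  rw [hentry, Matrix.reindex_apply, Matrix.submatrix_apply]
  have hTi : (fun a => (T : Matrix n n K) a i) = b (e.symm i) := by funext a; rw [hT]; rfl
  have hTj : (fun a => (T : Matrix n n K) a j) = b (e.symm j) := by funext a; rw [hT]; rfl
  rw [hTi, hTj]
  rcases hki : e.symm i with k | k | k <;> rcases hlj : e.symm j with l | l | l
  · simp [Matrix.fromBlocks_apply₁₁, h1]
  · simp [Matrix.fromBlocks_apply₁₂, Matrix.fromCols_apply_inl, h4]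
  · simp [Matrix.fromBlocks_apply₁₂, Matrix.fromCols_apply_inr, h3, Matrix.one_apply]
  · simp [Matrix.fromBlocks_apply₂₁, Matrix.fromRows_apply_inl, h4']
  · simp [Matrix.fromBlocks_apply₂₂, Matrix.fromBlocks_apply₁₁, Han]
  · simp [Matrix.fromBlocks_apply₂₂, Matrix.fromBlocks_apply₁₂, h5']
  · simp [Matrix.fromBlocks_apply₂₁, Matrix.fromRows_apply_inr, h3', Matrix.one_apply]
  · simp [Matrix.fromBlocks_apply₂₂, Matrix.fromBlocks_apply₂₁, h5]
  · simp [Matrix.fromBlocks_apply₂₂, h2']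

/-! ## §4 (ED. 2) The antidiagonal convention `W♭(r, H_an)`: f-slots reversed, pairing block `antidiag(1,…,1)`

In the block order `(e₁ … e_r ∣ an ∣ f_r … f_1)` (the `f`'s REVERSED, slot `j` holding `f_{rev j}`) the pairing block is the antidiagonal
`P_r = (δ_{i, rev j})`, the STANDARD PARABOLICS (stabilisers of `⟨e₁⟩ ⊂ ⟨e₁,e₂⟩ ⊂ ⋯`) are block-upper-triangular, and `r = ⌊N∕2⌋`,
`H_an = (1)` reproduces Mok's `Φ_N` (★ `StdForm.antidiagonal`).  This is the convention of the 13a defs leaf D₁ (`wittForm r H_an`,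
K2-defs1); the theorem below is the similitude onto it. -/

/-- **Witt normal form, antidiagonal convention**: as `exists_GL_formCongr_eq_wittMatrix`, with the pairing block
`P_r = Matrix.of (fun i j => if i = Fin.rev j then 1 else 0)` in place of `1` (index bijection composed with `Fin.rev` on the `f`-slots).
[cite: Dieudonne1971GroupesClassiques, Chap. I §11] -/
theorem exists_GL_formCongr_eq_wittMatrix_rev (hσ : ∀ a, σ (σ a) = a) (h2 : (2 : K) ≠ 0) (hJ : (J.map σ)ᵀ = J)
    (hJd : IsUnit J.det) :
    ∃ (r m : ℕ) (e : Fin r ⊕ (Fin m ⊕ Fin r) ≃ n) (T : GL n K) (Han : Matrix (Fin m) (Fin m) K),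
      2 * r + m = Fintype.card n ∧ (Han.map σ)ᵀ = Han ∧
      (∀ x : Fin m → K, hermForm σ Han x x = 0 → x = 0) ∧
      formCongr σ T J = Matrix.reindex e e
        (Matrix.fromBlocks (0 : Matrix (Fin r) (Fin r) K)
          (Matrix.fromCols (0 : Matrix (Fin r) (Fin m) K) (Matrix.of fun i j : Fin r => if i = Fin.rev j then (1 : K) else 0))
          (Matrix.fromRows (0 : Matrix (Fin m) (Fin r) K) (Matrix.of fun i j : Fin r => if i = Fin.rev j then (1 : K) else 0))
          (Matrix.fromBlocks Han 0 0 (0 : Matrix (Fin r) (Fin r) K))) := by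
  classical
  obtain ⟨r, m, e, T, Han, h7, hHan, hanis, hW⟩ := exists_GL_formCongr_eq_wittMatrix σ J hσ h2 hJ hJd
  -- reverse the `f`-slots
  let ρ : Fin r ⊕ (Fin m ⊕ Fin r) ≃ Fin r ⊕ (Fin m ⊕ Fin r) :=
    Equiv.sumCongr (Equiv.refl _) (Equiv.sumCongr (Equiv.refl _) Fin.revPerm)
  refine ⟨r, m, ρ.trans e, T, Han, h7, hHan, hanis, ?_⟩
  rw [hW]
  ext i j
  simp only [Matrix.reindex_apply, Matrix.submatrix_apply, Equiv.symm_trans_apply]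
  -- compare the two block matrices at `(a, b) = (e⁻¹ i, e⁻¹ j)` versus `(ρ⁻¹ a, ρ⁻¹ b)`
  generalize e.symm i = a
  generalize e.symm j = b
  rcases a with k | k | k <;> rcases b with l | l | l <;>
    simp [ρ, Matrix.fromBlocks_apply₁₁, Matrix.fromBlocks_apply₁₂, Matrix.fromBlocks_apply₂₁, Matrix.fromBlocks_apply₂₂,
      Matrix.fromCols_apply_inl, Matrix.fromCols_apply_inr, Matrix.fromRows_apply_inl, Matrix.fromRows_apply_inr,
      Matrix.one_apply, Fin.rev_inj]

end MatrixForm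

end Summit.HodgeConjecture.HodgeConjecture.Cruxes.H413.K2E3HermitianWittBasis
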